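import Literature.Probability.RandomPlanarGeometry.HexSAWBrickWallStripFugacityWidthOneContactPhaseCorners
import HarnessLib

/-!
# The cost of rung-free walks: the minimum of the extended rate on the adsorbed edge

Child module of `…ContactPhaseCorners` (`J̄_{y,z}(a, ½−a) = log μ₁(y,z) − a log y − (½−a) log z`, AFFINE along the adsorbed edge of the density
triangle = the density pairs of the rung-free walks).  An affine function on a segment is minimised at an end:
* §1 ★★ for `0 ≤ a ≤ ½`: `J̄(a, ½−a) ≥ log μ₁(y,z) − ½ log max(y,z)`, with equality at the vertex of the MORE ATTRACTIVE wall (`a = ½` if `y ≥ z`,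
  `a = 0` if `z ≥ y`); for `y = z` the rate is CONSTANT `log μ₁(y,y) − ½ log y` along the whole edge (every sharing of a rung-free walk between the
  two walls costs the same);
* §2 ★★ the COST OF RUNG-FREE WALKS `log μ₁(y,z) − ½ log max(y,z)` is positive (the tree's `max_lt_stripMuY₂_one_sq`) and is the least value of the
  extended rate over the closed adsorbed edge (`isLeast_rateExt_adsorbedEdge`).

## Sources
JansevanRensburg2000 §5 (1st ed., OUP 2000: adsorbing walks); DemboZeitouni2010 §2.2 (lane statement).  Nothing quoted AS PRINTED.
-/

noncomputable section

open Filter Topology Finset Literature.Probability.LatticeModels Literature.Probability.Percolation SimpleGraph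

namespace Literature.Probability.RandomPlanarGeometry.SAW.HexBW

open WidthOneYZ Real

variable {y z : ℝ}

/-! ## §1 The affine rate on the adsorbed edge and its minimum -/

/-- ★★ **Lower bound on the adsorbed edge**: for `y, z > 0` and `0 ≤ a ≤ ½`,
`log μ₁(y,z) − ½ log max(y,z) ≤ log μ₁(y,z) − a log y − (½ − a) log z` (= `J̄(a, ½−a)` by `rateExt_adsorbedEdge`).
[cite: JansevanRensburg2000, §5 (1st ed.; lane statement)] -/
theorem rungFreeCost_le_rateExt_edge (hy : 0 < y) (hz : 0 < z) {a : ℝ} (ha0 : 0 ≤ a) (ha1 : a ≤ 1 / 2) :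
    Real.log (stripMuY₂ 1 y z) - Real.log (max y z) / 2 ≤
      Real.log (stripMuY₂ 1 y z) - a * Real.log y - (1 / 2 - a) * Real.log z := by
  have hly : Real.log y ≤ Real.log (max y z) := Real.log_le_log hy (le_max_left _ _)
  have hlz : Real.log z ≤ Real.log (max y z) := Real.log_le_log hz (le_max_right _ _)
  have h1 : a * Real.log y ≤ a * Real.log (max y z) := mul_le_mul_of_nonneg_left hly ha0
  have h2 : (1 / 2 - a) * Real.log z ≤ (1 / 2 - a) * Real.log (max y z) := mul_le_mul_of_nonneg_left hlz (by linarith)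
  linarith

/-- ★★ **Attained at the vertex of the more attractive wall**: if `z ≤ y` the bound is attained at `a = ½` (all contacts on the bottom wall),
if `y ≤ z` at `a = 0`. [cite: JansevanRensburg2000, §5 (1st ed.; lane statement)] -/
theorem rateExt_edge_eq_rungFreeCost (y z : ℝ) :
    (z ≤ y → Real.log (stripMuY₂ 1 y z) - 1 / 2 * Real.log y - (1 / 2 - 1 / 2) * Real.log z =
        Real.log (stripMuY₂ 1 y z) - Real.log (max y z) / 2) ∧
    (y ≤ z → Real.log (stripMuY₂ 1 y z) - 0 * Real.log y - (1 / 2 - 0) * Real.log z =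
        Real.log (stripMuY₂ 1 y z) - Real.log (max y z) / 2) := by
  constructor
  · intro h; rw [max_eq_left h]; ring
  · intro h; rw [max_eq_right h]; ring

/-- ★★ **Equal walls: the rate is constant along the adsorbed edge** — for `y = z` every sharing `(a, ½ − a)` of a rung-free walk costs
`log μ₁(y,y) − ½ log y`. [cite: JansevanRensburg2000, §5 (1st ed.; lane statement)] -/
theorem rateExt_edge_diag (y a : ℝ) :
    Real.log (stripMuY₂ 1 y y) - a * Real.log y - (1 / 2 - a) * Real.log y = Real.log (stripMuY₂ 1 y y) - Real.log y / 2 := by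
  ring

/-! ## §2 The cost of rung-free walks -/

/-- ★★ **THE COST OF RUNG-FREE WALKS IS POSITIVE**: `0 < log μ₁(y,z) − ½ log max(y,z)` for all `y, z > 0` (`μ₁(y,z)² > max(y,z)`, the tree's
`max_lt_stripMuY₂_one_sq`). [cite: JansevanRensburg2000, §5 (1st ed.; lane statement); BeatonBousquetMelouDeGierDuminilCopinGuttmann2014, §3.2 Proposition 6 (arXiv v5 p. 10)] -/
theorem rungFreeCost_pos (hy : 0 < y) (hz : 0 < z) : 0 < Real.log (stripMuY₂ 1 y z) - Real.log (max y z) / 2 := by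
  have hμ := stripMuY₂_pos 1 hy hz
  have hmax : 0 < max y z := lt_max_of_lt_left hy
  have h := max_lt_stripMuY₂_one_sq hy hz
  have hlog : Real.log (max y z) < Real.log (stripMuY₂ 1 y z ^ 2) := Real.log_lt_log hmax h
  rw [Real.log_pow] at hlog
  push_cast at hlog
  linarith

/-- ★★ **THE MINIMUM OF THE EXTENDED RATE OVER THE CLOSED ADSORBED EDGE** is the cost of rung-free walks
`log μ₁(y,z) − ½ log max(y,z)` (with `rateExt_adsorbedEdge`: the values `J̄(a, ½−a)`, `0 ≤ a ≤ ½`).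
[cite: JansevanRensburg2000, §5 (1st ed.; lane statement); DemboZeitouni2010, §2.2] -/
theorem isLeast_rateExt_adsorbedEdge (hy : 0 < y) (hz : 0 < z) :
    IsLeast {r : ℝ | ∃ a : ℝ, 0 ≤ a ∧ a ≤ 1 / 2 ∧ r = Real.log (stripMuY₂ 1 y z) - a * Real.log y - (1 / 2 - a) * Real.log z}
      (Real.log (stripMuY₂ 1 y z) - Real.log (max y z) / 2) := by
  refine ⟨?_, ?_⟩
  · rcases le_total z y with h | h
    · refine ⟨1 / 2, by norm_num, le_rfl, ?_⟩
      rw [max_eq_left h]; ring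
    · refine ⟨0, le_rfl, by norm_num, ?_⟩
      rw [max_eq_right h]; ring
  · rintro r ⟨a, ha0, ha1, rfl⟩
    exact rungFreeCost_le_rateExt_edge hy hz ha0 ha1

end Literature.Probability.RandomPlanarGeometry.SAW.HexBW
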